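import Literature.Probability.LatticeModels.BinomialEntropy
import Literature.Analysis.SpecialFunctions.GaussianRiemannSums
import Mathlib.Analysis.SpecialFunctions.Pow.Real
import Mathlib.Analysis.Complex.ExponentialBounds
import Mathlib.Analysis.Real.Pi.Bounds
import HarnessLib

/-!
# A Laplace-method bound for binomially weighted sums `∑_z C(n,z) q_z^m`

`Literature/Combinatorics`. The upper half of the "Laplace lemma" that drives second-moment
calculations for random constraint satisfaction problems — Achlioptas–Moore (FOCS 2002 / SIAM J.
Comput. 36 (2006), Lemma 2) and Achlioptas–Peres (J. AMS 17 (2004), Lemma 2; arXiv:cs/0305009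
p. 10): *if `g(α) = φ(α)/(α^α (1-α)^{1-α})` has a unique global maximum on `[0,1]` at `α_max` with
`g''(α_max) < 0`, then `∑_{z=0}^n C(n,z) φ(z/n)^n ≤ C · g_max^n`* — in the quantitative,
ELEMENTARY form in which it is used at `α_max = 1/2` (second moment of balanced/NAE/`k`-SAT counts),
with the unique-maximum-plus-curvature hypothesis replaced by the single quadratic domination
hypothesis it implies on `[0,1]`:

* `sum_choose_mul_pow_le_two_pow` — for every `κ > 0` there is `C = C(κ)` such that for all `n, m`,
  all `r ≥ 0` with `m ≤ r n`, and all `q_0, …, q_n ≥ 0` with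
  `q_z^r ≤ exp(h(x_z) - κ x_z²)`, `x_z = (2z-n)/n`, `h = spinRate` (`h(x) = log 2 - H((1+x)/2)`,
  the rate function of a fair `±1` spin, `Literature.Probability.LatticeModels.spinRate`), one has
  `∑_{z=0}^{n} C(n,z) q_z^m ≤ C · 2^n`. In the application `q_z = f(z/n)/f(1/2)` is the pair
  correlation at overlap `z` and the hypothesis says `g_r(α) ≤ g_r(1/2) e^{-κ(2α-1)²}`; the
  conclusion is `E[X²] ≤ C · E[X]²`.

Proof (de Moivre–Laplace by hand, no measure theory): `q_z^m ≤ 1 + (q_z^r)^n` (cases `q_z ≤ 1`,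
`q_z > 1` with `m ≤ rn`); `C(n,z) ≤ 2^n e^{-n h(x_z)}` always
(`Literature.Probability.LatticeModels.choose_le_exp_spinRate`) and
`C(n,z) ≤ (2/√n) 2^n e^{-n h(x_z)}` in the bulk `n/4 ≤ z ≤ 3n/4` (Stirling,
`Literature.Probability.LatticeModels.choose_eq_stirlingRatio` + `stirlingRatio_le`,
`choose_mul_exp_le_bulk`); so a bulk term is `≤ 2^n (2/√n) e^{-κ(2z-n)²/n}` and a tail term is
`≤ 2^n e^{-κ n/4}`; the Gaussian sum is `∑_z e^{-κ(2z-n)²/n} ≤ 2 + √(π n/κ)`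
(`sum_range_exp_neg_mul_sq_div_le`, from the Riemann bound
`Literature.Analysis.SpecialFunctions.sum_range_exp_neg_sq_succ_le`) and `(n+1) e^{-κn/4} ≤ 1 + 8/κ`.
The constant obtained is `C = 6 + 8/κ + 2√(π/κ)`.

Not here: the matching lower bound `B g_max^n ≤ S_n` of the printed lemma, general `α_max`, and
the derivation of the quadratic domination from `g'' < 0` + uniqueness (compactness); users supply
the domination directly (it is what the calculus in the applications actually proves).

## References

* D. Achlioptas, Y. Peres, *The threshold for random `k`-SAT is `2^k log 2 - O(k)`*, J. Amer.
  Math. Soc. 17 (2004) 947–973, Lemma 2 (arXiv:cs/0305009 p. 10). [AchlioptasPeres2004]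
* D. Achlioptas, C. Moore, *Random `k`-SAT: two moments suffice to cross a sharp threshold*,
  SIAM J. Comput. 36 (2006) 740–762, Lemma 2 / Appendix A (the Laplace-method proof).
  [AchlioptasMoore2006]
* N. G. de Bruijn, *Asymptotic Methods in Analysis*, Dover 1981, §4 (Laplace method).
-/

noncomputable section

namespace Literature.Combinatorics

open Real Finset Literature.Probability.LatticeModels

/-- **Bulk Stirling bound for binomial coefficients**: for `n/4 ≤ z ≤ 3n/4` (and `n ≥ 1`),
`C(n,z) ≤ (2/√n) · 2^n e^{-n h((2z-n)/n)}`, `h = spinRate` (from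
`C(n,z) = [s(n)/(s(z)s(n-z))] √(n/(2z(n-z))) 2^n e^{-nh}` with `s(n)/(s(z)s(n-z)) ≤ e/(√2 π)` and
`z(n-z) ≥ 3n²/16`). [cite: AchlioptasMoore2006, Lemma 2 / Appendix A (the `Θ(n^{-1/2})` size of the central terms)] -/
theorem choose_mul_exp_le_bulk {n z : ℕ} (hn : 1 ≤ n) (hz₁ : n ≤ 4 * z) (hz₂ : 4 * z ≤ 3 * n) :
    (n.choose z : ℝ) ≤ 2 / Real.sqrt n * (2 ^ n * Real.exp (-(n * spinRate ((2 * z - n) / n)))) := by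
  have hz1 : 1 ≤ z := by omega
  have hzn : z + 1 ≤ n := by omega
  rw [choose_eq_stirlingRatio hz1 hzn]
  apply mul_le_mul_of_nonneg_right _ (by positivity)
  -- `A := ratio * √(n/(2z(n-z)))` satisfies `A √n ≤ 2`
  have hR0 : 0 < stirlingRatio n z := stirlingRatio_pos hz1 hzn
  have hR : stirlingRatio n z ≤ Real.exp 1 / (Real.sqrt 2 * π) := stirlingRatio_le hz1 hzn
  have hnpos : (0 : ℝ) < n := by exact_mod_cast (show 0 < n by omega)
  have hzpos : (0 : ℝ) < z := by exact_mod_cast (show 0 < z by omega)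
  have hnz : (0 : ℝ) < (n : ℝ) - z := by
    have : (z : ℝ) + 1 ≤ n := by exact_mod_cast hzn
    linarith
  have hprod : 3 * (n : ℝ) ^ 2 ≤ 16 * (z * ((n : ℝ) - z)) := by
    have h1 : (n : ℝ) ≤ 4 * z := by exact_mod_cast hz₁
    have h2 : 4 * (z : ℝ) ≤ 3 * n := by exact_mod_cast hz₂
    nlinarith
  -- square of the Stirling ratio is at most 1/2
  have hR2 : stirlingRatio n z ^ 2 ≤ 1 / 2 := by
    have he : Real.exp 1 < 2.7182818286 := Real.exp_one_lt_d9
    have hπ : (3.14 : ℝ) < π := Real.pi_gt_d2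
    have hs2 : Real.sqrt 2 ^ 2 = 2 := Real.sq_sqrt (by norm_num)
    have hden : 0 < Real.sqrt 2 * π := by positivity
    have h1 : stirlingRatio n z ^ 2 ≤ (Real.exp 1 / (Real.sqrt 2 * π)) ^ 2 :=
      pow_le_pow_left₀ hR0.le hR 2
    have h2 : (Real.exp 1 / (Real.sqrt 2 * π)) ^ 2 = Real.exp 1 ^ 2 / (2 * π ^ 2) := by
      rw [div_pow, mul_pow, hs2]
    rw [h2] at h1
    have h3 : Real.exp 1 ^ 2 / (2 * π ^ 2) ≤ 1 / 2 := by
      rw [div_le_div_iff₀ (by positivity) (by norm_num)]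
      have he0 : 0 < Real.exp 1 := Real.exp_pos 1
      nlinarith
    exact h1.trans h3
  have hsq : n / (2 * z * ((n : ℝ) - z)) ≤ 8 / (3 * n) := by
    rw [div_le_div_iff₀ (by positivity) (by positivity)]
    nlinarith
  set A := stirlingRatio n z * Real.sqrt (n / (2 * z * ((n : ℝ) - z))) with hA
  have hA0 : 0 ≤ A := by positivity
  have hAsq : (A * Real.sqrt n) ^ 2 ≤ 2 ^ 2 := by
    rw [mul_pow, hA, mul_pow, Real.sq_sqrt (by positivity), Real.sq_sqrt hnpos.le]
    calc stirlingRatio n z ^ 2 * (n / (2 * z * ((n : ℝ) - z))) * n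
        ≤ 1 / 2 * (8 / (3 * n)) * n := by gcongr
      _ = 4 / 3 := by field_simp; ring
      _ ≤ 2 ^ 2 := by norm_num
  have hAn : A * Real.sqrt n ≤ 2 := by
    have := (pow_le_pow_iff_left₀ (by positivity) (by norm_num) two_ne_zero).mp hAsq
    exact this
  rw [le_div_iff₀ (Real.sqrt_pos.mpr hnpos)]
  exact hAn

/-- **The Gaussian sum on the overlap grid**: for `κ > 0` and `n ≥ 1`,
`∑_{z=0}^{n} e^{-κ(2z-n)²/n} ≤ 2 + √(πn/κ)` (reindex `j = |2z - n|` on each side of `n/2` and use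
the Riemann bound `∑_{j≥1} e^{-κ j²/n} ≤ √(πn/κ)/2`,
`Literature.Analysis.SpecialFunctions.sum_range_exp_neg_sq_succ_le`). [folklore] -/
theorem sum_range_exp_neg_mul_sq_div_le {κ : ℝ} (hκ : 0 < κ) {n : ℕ} (hn : 1 ≤ n) :
    ∑ z ∈ range (n + 1), Real.exp (-(κ * (2 * z - n : ℝ) ^ 2 / n)) ≤ 2 + Real.sqrt (π * n / κ) := by
  have hnpos : (0 : ℝ) < n := by exact_mod_cast (show 0 < n by omega)
  set g : ℕ → ℝ := fun j => Real.exp (-(κ * (j : ℝ) ^ 2 / n)) with hg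
  -- the one-sided Gaussian sum
  have hG : ∑ j ∈ range (n + 1), g j ≤ 1 + Real.sqrt (π * n / κ) / 2 := by
    rw [Finset.sum_range_succ']
    have h0 : g 0 = 1 := by simp [hg]
    rw [h0]
    suffices hS : ∑ k ∈ range n, g (k + 1) ≤ Real.sqrt (π * n / κ) / 2 by linarith
    have hh : 0 < Real.sqrt (κ / n) := Real.sqrt_pos.mpr (div_pos hκ hnpos)
    have h := Literature.Analysis.SpecialFunctions.sum_range_exp_neg_sq_succ_le hh n
    have hval : Real.sqrt π / (2 * Real.sqrt (κ / n)) = Real.sqrt (π * n / κ) / 2 := by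
      rw [Real.sqrt_div' _ hnpos.le, show π * n / κ = π * (n / κ) by ring,
        Real.sqrt_mul Real.pi_pos.le, Real.sqrt_div' _ hκ.le]
      field_simp
    rw [hval] at h
    convert h using 2 with j _
    simp only [hg]
    congr 1
    rw [mul_pow, Real.sq_sqrt (div_pos hκ hnpos).le]
    push_cast
    ring
  -- split the sum at `n/2` and reindex each half injectively into `j = |2z - n|`
  set f : ℕ → ℝ := fun z => Real.exp (-(κ * (2 * z - n : ℝ) ^ 2 / n)) with hf
  have hfg₁ : ∀ z, n ≤ 2 * z → f z = g (2 * z - n) := by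
    intro z hz
    simp only [hf, hg]
    push_cast [Nat.cast_sub hz]
    ring_nf
  have hfg₂ : ∀ z, 2 * z < n → f z = g (n - 2 * z) := by
    intro z hz
    simp only [hf, hg]
    push_cast [Nat.cast_sub hz.le]
    congr 2
    ring
  have hA : ∑ z ∈ (range (n + 1)).filter (fun z => n ≤ 2 * z), f z ≤ ∑ j ∈ range (n + 1), g j := by
    calc ∑ z ∈ (range (n + 1)).filter (fun z => n ≤ 2 * z), f z
        = ∑ z ∈ (range (n + 1)).filter (fun z => n ≤ 2 * z), g (2 * z - n) := by
          refine Finset.sum_congr rfl fun z hz => ?_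
          exact hfg₁ z (Finset.mem_filter.mp hz).2
      _ = ∑ j ∈ ((range (n + 1)).filter (fun z => n ≤ 2 * z)).image (fun z => 2 * z - n), g j := by
          rw [Finset.sum_image]
          intro a ha b hb hab
          simp only [Finset.coe_filter, Finset.mem_range, Set.mem_setOf_eq] at ha hb
          dsimp only at hab
          omega
      _ ≤ ∑ j ∈ range (n + 1), g j := by
          apply Finset.sum_le_sum_of_subset_of_nonneg
          · intro j hj
            simp only [Finset.mem_image, Finset.mem_filter, Finset.mem_range] at hj ⊢
            obtain ⟨a, ⟨ha1, ha2⟩, rfl⟩ := hj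
            omega
          · intro j _ _
            positivity
  have hB : ∑ z ∈ (range (n + 1)).filter (fun z => ¬ n ≤ 2 * z), f z ≤ ∑ j ∈ range (n + 1), g j := by
    calc ∑ z ∈ (range (n + 1)).filter (fun z => ¬ n ≤ 2 * z), f z
        = ∑ z ∈ (range (n + 1)).filter (fun z => ¬ n ≤ 2 * z), g (n - 2 * z) := by
          refine Finset.sum_congr rfl fun z hz => ?_
          exact hfg₂ z (not_le.mp (Finset.mem_filter.mp hz).2)
      _ = ∑ j ∈ ((range (n + 1)).filter (fun z => ¬ n ≤ 2 * z)).image (fun z => n - 2 * z), g j := by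
          rw [Finset.sum_image]
          intro a ha b hb hab
          simp only [Finset.coe_filter, Finset.mem_range, Set.mem_setOf_eq] at ha hb
          dsimp only at hab
          omega
      _ ≤ ∑ j ∈ range (n + 1), g j := by
          apply Finset.sum_le_sum_of_subset_of_nonneg
          · intro j hj
            simp only [Finset.mem_image, Finset.mem_filter, Finset.mem_range] at hj ⊢
            obtain ⟨a, ⟨ha1, ha2⟩, rfl⟩ := hj
            omega
          · intro j _ _
            positivity
  rw [← Finset.sum_filter_add_sum_filter_not (range (n + 1)) (fun z => n ≤ 2 * z) f]
  linarith

/-- `(n+1) e^{-a n} ≤ 1 + 2/a` for `a > 0` (from `1 + an/2 ≤ e^{an/2}`). [folklore] -/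
theorem succ_mul_exp_neg_mul_le {a : ℝ} (ha : 0 < a) (n : ℕ) :
    ((n : ℝ) + 1) * Real.exp (-(a * n)) ≤ 1 + 2 / a := by
  have hn : (0 : ℝ) ≤ n := Nat.cast_nonneg n
  have h1 : a * n / 2 + 1 ≤ Real.exp (a * n / 2) := Real.add_one_le_exp _
  have h2 : (n : ℝ) ≤ 2 / a * Real.exp (a * n / 2) := by
    rw [div_mul_eq_mul_div, le_div_iff₀ ha]
    nlinarith
  have h3 : Real.exp (-(a * n)) ≤ 1 := by
    rw [Real.exp_le_one_iff]; nlinarith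
  have h4 : (n : ℝ) * Real.exp (-(a * n)) ≤ 2 / a * Real.exp (-(a * n / 2)) := by
    calc (n : ℝ) * Real.exp (-(a * n)) ≤ 2 / a * Real.exp (a * n / 2) * Real.exp (-(a * n)) :=
          mul_le_mul_of_nonneg_right h2 (Real.exp_pos _).le
      _ = 2 / a * Real.exp (-(a * n / 2)) := by
          rw [mul_assoc, ← Real.exp_add]; congr 2; ring
  have h5 : Real.exp (-(a * n / 2)) ≤ 1 := by
    rw [Real.exp_le_one_iff]; nlinarith
  have h6 : 2 / a * Real.exp (-(a * n / 2)) ≤ 2 / a := by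
    have : 0 ≤ 2 / a := by positivity
    nlinarith
  nlinarith [Real.exp_pos (-(a * n))]

/-- **Laplace-method bound for binomially weighted sums** (the upper half of the Laplace lemma of
Achlioptas–Moore / Achlioptas–Peres, Lemma 2 loc. cit., at `α_max = 1/2`, in quantitative
elementary form). Let `κ > 0`. There is `C > 0` (namely `6 + 8/κ + 2√(π/κ)`) such that for all
`n, m ∈ ℕ`, all real `r ≥ 0` with `m ≤ r n`, and all `q : ℕ → ℝ` with `q_z ≥ 0` and
`q_z^r ≤ exp(h(x_z) - κ x_z²)` for `z ≤ n`, where `x_z = (2z-n)/n` and `h = spinRate`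
(`= log 2 -` binary entropy of `z/n`), one has `∑_{z=0}^{n} C(n,z) q_z^m ≤ C · 2^n`.
(In the second-moment method: `q_z = f(z/n)/f(1/2)`, the hypothesis is
"`g_r(α) ≤ g_r(1/2) e^{-κ(2α-1)²}` on `[0,1]`", the conclusion is `E[X²] ≤ C E[X]²`.)
[cite: AchlioptasPeres2004, Lemma 2 (arXiv:cs/0305009 p. 10), upper bound; AchlioptasMoore2006, Lemma 2] -/
theorem sum_choose_mul_pow_le_two_pow {κ : ℝ} (hκ : 0 < κ) :
    ∃ C : ℝ, 0 < C ∧ ∀ (n m : ℕ) (r : ℝ), 0 ≤ r → (m : ℝ) ≤ r * n → ∀ q : ℕ → ℝ,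
      (∀ z : ℕ, z ≤ n → 0 ≤ q z ∧
        q z ^ r ≤ Real.exp (spinRate ((2 * z - n) / n) - κ * ((2 * z - n) / n) ^ 2)) →
      ∑ z ∈ range (n + 1), (n.choose z : ℝ) * q z ^ m ≤ C * 2 ^ n := by
  refine ⟨6 + 8 / κ + 2 * Real.sqrt (π / κ), by positivity, ?_⟩
  intro n m r hr hm q hq
  rcases Nat.eq_zero_or_pos n with rfl | hn
  · -- `n = 0`: then `m = 0` and the sum is `1`
    have hm0 : m = 0 := by
      have : (m : ℝ) ≤ 0 := by simpa using hm
      exact_mod_cast le_antisymm this (Nat.cast_nonneg m)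
    subst hm0
    simp only [zero_add, Finset.range_one, Finset.sum_singleton, Nat.choose_self, Nat.cast_one,
      pow_zero, mul_one]
    have : 0 ≤ 8 / κ + 2 * Real.sqrt (π / κ) := by positivity
    linarith
  have hn1 : 1 ≤ n := hn
  have hnpos : (0 : ℝ) < n := by exact_mod_cast hn
  -- termwise bound
  have hterm : ∀ z ∈ range (n + 1), (n.choose z : ℝ) * q z ^ m ≤
      (n.choose z : ℝ) + 2 ^ n * (2 / Real.sqrt n * Real.exp (-(κ * (2 * z - n : ℝ) ^ 2 / n)) +
        Real.exp (-(κ / 4 * n))) := by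
    intro z hz
    have hzn : z ≤ n := Nat.lt_succ_iff.mp (Finset.mem_range.mp hz)
    obtain ⟨hq0, hqr⟩ := hq z hzn
    have hchoose0 : (0 : ℝ) ≤ n.choose z := Nat.cast_nonneg _
    have hgauss0 : 0 ≤ 2 / Real.sqrt n * Real.exp (-(κ * (2 * z - n : ℝ) ^ 2 / n)) := by
      positivity
    have htail0 : 0 ≤ Real.exp (-(κ / 4 * n)) := (Real.exp_pos _).le
    by_cases hq1 : q z ≤ 1
    · -- `q_z ≤ 1`: the term is at most `C(n,z)`
      have : q z ^ m ≤ 1 := pow_le_one₀ hq0 hq1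
      calc (n.choose z : ℝ) * q z ^ m ≤ (n.choose z : ℝ) * 1 :=
            mul_le_mul_of_nonneg_left this hchoose0
        _ ≤ _ := by rw [mul_one]; nlinarith [pow_pos (two_pos : (0:ℝ) < 2) n]
    · -- `q_z > 1`: `q_z^m ≤ (q_z^r)^n ≤ e^{n h(x_z)} e^{-n κ x_z²}`
      push Not at hq1
      set x : ℝ := (2 * z - n) / n with hx
      have hpow : q z ^ m ≤ Real.exp (n * spinRate x) * Real.exp (-(κ * (2 * z - n : ℝ) ^ 2 / n)) := by
        have h1 : q z ^ m ≤ (q z ^ r) ^ n := by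
          rw [← Real.rpow_natCast (q z) m, ← Real.rpow_natCast (q z ^ r) n,
            ← Real.rpow_mul hq0]
          exact Real.rpow_le_rpow_of_exponent_le hq1.le hm
        have h2 : (q z ^ r) ^ n ≤ (Real.exp (spinRate x - κ * x ^ 2)) ^ n :=
          pow_le_pow_left₀ (Real.rpow_nonneg hq0 r) hqr n
        have h3 : (Real.exp (spinRate x - κ * x ^ 2)) ^ n =
            Real.exp (n * spinRate x) * Real.exp (-(κ * (2 * z - n : ℝ) ^ 2 / n)) := by
          rw [← Real.exp_nat_mul, ← Real.exp_add]
          congr 1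
          rw [hx]
          field_simp
          ring
        exact h1.trans (h2.trans h3.le)
      by_cases hbulk : n ≤ 4 * z ∧ 4 * z ≤ 3 * n
      · -- bulk: Stirling saves `√n`
        have hc := choose_mul_exp_le_bulk hn1 hbulk.1 hbulk.2
        calc (n.choose z : ℝ) * q z ^ m
            ≤ 2 / Real.sqrt n * (2 ^ n * Real.exp (-(n * spinRate x))) *
                (Real.exp (n * spinRate x) * Real.exp (-(κ * (2 * z - n : ℝ) ^ 2 / n))) :=
              mul_le_mul hc hpow (pow_nonneg hq0 m) (by positivity)
          _ = 2 ^ n * (2 / Real.sqrt n * Real.exp (-(κ * (2 * z - n : ℝ) ^ 2 / n))) := by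
              have : Real.exp (-(n * spinRate x)) * Real.exp (n * spinRate x) = 1 := by
                rw [← Real.exp_add, neg_add_cancel, Real.exp_zero]
              calc 2 / Real.sqrt n * (2 ^ n * Real.exp (-(n * spinRate x))) *
                    (Real.exp (n * spinRate x) * Real.exp (-(κ * (2 * z - n : ℝ) ^ 2 / n)))
                  = 2 ^ n * (2 / Real.sqrt n * Real.exp (-(κ * (2 * z - n : ℝ) ^ 2 / n))) *
                      (Real.exp (-(n * spinRate x)) * Real.exp (n * spinRate x)) := by ring
                _ = _ := by rw [this, mul_one]
          _ ≤ _ := by nlinarith [pow_pos (two_pos : (0:ℝ) < 2) n]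
      · -- tail: `x_z² ≥ 1/4`
        have hc := choose_le_exp_spinRate hzn
        have hx2 : 1 / 4 ≤ x ^ 2 := by
          rw [hx, div_pow]
          rw [le_div_iff₀ (by positivity)]
          rcases not_and_or.mp hbulk with h | h
          · have h' : 4 * (z : ℝ) < n := by exact_mod_cast not_le.mp h
            nlinarith
          · have h' : 3 * (n : ℝ) < 4 * z := by exact_mod_cast not_le.mp h
            nlinarith
        have hgauss : Real.exp (-(κ * (2 * z - n : ℝ) ^ 2 / n)) ≤ Real.exp (-(κ / 4 * n)) := by
          apply Real.exp_le_exp.mpr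
          have : κ * (2 * z - n : ℝ) ^ 2 / n = κ * x ^ 2 * n := by
            rw [hx]; field_simp
          rw [this]
          nlinarith [mul_le_mul_of_nonneg_left hx2 hκ.le]
        calc (n.choose z : ℝ) * q z ^ m
            ≤ 2 ^ n * Real.exp (-(n * spinRate x)) *
                (Real.exp (n * spinRate x) * Real.exp (-(κ * (2 * z - n : ℝ) ^ 2 / n))) :=
              mul_le_mul hc hpow (pow_nonneg hq0 m) (by positivity)
          _ = 2 ^ n * Real.exp (-(κ * (2 * z - n : ℝ) ^ 2 / n)) := by
              have : Real.exp (-(n * spinRate x)) * Real.exp (n * spinRate x) = 1 := by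
                rw [← Real.exp_add, neg_add_cancel, Real.exp_zero]
              calc 2 ^ n * Real.exp (-(n * spinRate x)) *
                    (Real.exp (n * spinRate x) * Real.exp (-(κ * (2 * z - n : ℝ) ^ 2 / n)))
                  = 2 ^ n * Real.exp (-(κ * (2 * z - n : ℝ) ^ 2 / n)) *
                      (Real.exp (-(n * spinRate x)) * Real.exp (n * spinRate x)) := by ring
                _ = _ := by rw [this, mul_one]
          _ ≤ 2 ^ n * Real.exp (-(κ / 4 * n)) :=
              mul_le_mul_of_nonneg_left hgauss (pow_nonneg zero_le_two n)
          _ ≤ _ := by nlinarith [pow_pos (two_pos : (0:ℝ) < 2) n]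
  -- sum the termwise bound
  have hsum := Finset.sum_le_sum hterm
  have hchoose : ∑ z ∈ range (n + 1), (n.choose z : ℝ) = 2 ^ n := by
    exact_mod_cast Nat.sum_range_choose n
  have hG := sum_range_exp_neg_mul_sq_div_le hκ hn1
  have hK := succ_mul_exp_neg_mul_le (a := κ / 4) (by positivity) n
  rw [Finset.sum_add_distrib, hchoose, ← Finset.mul_sum, Finset.sum_add_distrib,
    ← Finset.mul_sum, Finset.sum_const, Finset.card_range, nsmul_eq_mul] at hsum
  have hsqrt : 2 / Real.sqrt n * ∑ z ∈ range (n + 1), Real.exp (-(κ * (2 * z - n : ℝ) ^ 2 / n)) ≤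
      4 + 2 * Real.sqrt (π / κ) := by
    have hs0 : 0 < Real.sqrt n := Real.sqrt_pos.mpr hnpos
    have hs1 : 1 ≤ Real.sqrt n := by
      rw [← Real.sqrt_one]; exact Real.sqrt_le_sqrt (by exact_mod_cast hn1)
    calc 2 / Real.sqrt n * ∑ z ∈ range (n + 1), Real.exp (-(κ * (2 * z - n : ℝ) ^ 2 / n))
        ≤ 2 / Real.sqrt n * (2 + Real.sqrt (π * n / κ)) :=
          mul_le_mul_of_nonneg_left hG (by positivity)
      _ = 4 / Real.sqrt n + 2 * Real.sqrt (π / κ) := by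
          rw [show π * n / κ = π / κ * n by ring, Real.sqrt_mul (by positivity)]
          field_simp
          ring
      _ ≤ 4 + 2 * Real.sqrt (π / κ) := by
          have : 4 / Real.sqrt n ≤ 4 := by
            rw [div_le_iff₀ hs0]; nlinarith
          linarith
  have hKK : ((n : ℝ) + 1) * Real.exp (-(κ / 4 * n)) ≤ 1 + 8 / κ := by
    have : 2 / (κ / 4) = 8 / κ := by field_simp; ring
    rw [this] at hK; exact hK
  have h2n : (0 : ℝ) < 2 ^ n := pow_pos two_pos n
  push_cast at hsum
  have hmid : 2 ^ n * (2 / Real.sqrt n * ∑ z ∈ range (n + 1),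
      Real.exp (-(κ * (2 * z - n : ℝ) ^ 2 / n)) + ((n : ℝ) + 1) * Real.exp (-(κ / 4 * n))) ≤
      2 ^ n * ((4 + 2 * Real.sqrt (π / κ)) + (1 + 8 / κ)) :=
    mul_le_mul_of_nonneg_left (add_le_add hsqrt hKK) h2n.le
  have hfin : (2 : ℝ) ^ n + 2 ^ n * ((4 + 2 * Real.sqrt (π / κ)) + (1 + 8 / κ)) =
      (6 + 8 / κ + 2 * Real.sqrt (π / κ)) * 2 ^ n := by ring
  linarith

end Literature.Combinatorics

end
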